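/-
Copyright (c) 2026 the pub-hodgecm-mathlib formalisation cell (harness21).  Prover seat hodgecm-mathlib-LH4-p11 (g7), req620 Track A «(D-RAM) FOUR-FRAME» squad, helper lane
on h413 = stmt-HodgeConjecture-24833 (count-neutral).  STAGE-1b brick (c5) of the seat's KNOCK 2026-09-04T08:24Z (claimed 09:02Z): central rescaling for the LEVEL counts.
2026-09-04.
-/
import Summits.HodgeConjecture.HodgeConjecture.Theorems.F0P3cDyRamProfileCountCentralRescaling   -- ★ p858731 (this seat): §1 tokens `latticeInLevel_iff_of_eq_smul`, `latticeInLevel_sq_iff_of_eq_smul`, `sub_one_mulVec_mem_of_mapGL_eq`; brings ★ U2G DEFS, ★ `mapGL_eq_of_coe_eq_smul`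
import HarnessLib

/-!
# Crux `H413`, line LH4 «(D-RAM) FOUR-FRAME» — THE LEVEL COUNTS `#{M | T·M = M, (T−1)·M ⊆ ϖ^a M, (T−1)²·M ⊆ ϖ^b M}` AND `#{M | T·M = M, (T−1)²·M ⊆ ϖ^b M}` (the
# census functions of ★ `pieceCountDictionary_levels` ∕ `pieceCountDictionary_sqLevel`) ARE BLIND TO A CENTRAL RESCALING `T ↦ z·T`, `|z| = 1`, `|z − 1| ≤ |ϖ|^a ∧ |ϖ|^b`

Cell `hodgecm-mathlib` (D-0151), FLOOR 0, crux item H413 = `stmt-HodgeConjecture-24833`, route of record `HCCMUnconditional`; squad F0∕P3c∕LH4 (req618∕req620); helper lane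
`--supports stmt-HodgeConjecture-24833 --as helper` (count-neutral).  THEOREMS ONLY (no `def`, no instance, no notation, no `sorry`, default heartbeats); datum-free `K`.

WHY (STAGE-1b; LEAD T19-24 scoping lane).  By ★ p858649 (F0P3a-p01 (g35)) the three open tier-0 rows reduce to rows of `f_{T+}` and of the CONGRUENCE-LEVEL PIECES
`𝟙_{K_{a,b}}` (`(a, b) ∈ {(ℓ₀, m*), (ℓ₀+1, m*)}`) and `𝟙{u ∈ K ∣ X² ∈ ϖ^{m*}M₃}`; their (D-G) dictionaries are ★ p858704 (LH4-p06 (g6)), with the census functions written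
INLINE as the two `Set.ncard`s of the title.  Feeding those rows frame-level census laws through the (J) socket ★ p858674 needs — exactly as ★ (c3)∕(c4) do for `cntStar` —
that the counts at the (D-CΔ)-S literal `ι_w t_b = z·Γ_b` equal the counts at the frame `Γ_b` on a window `|z − 1| ≤ |ϖ|^{max a b}`.  THIS FILE: the two count identities,
in ★ p858704's set-builder currency token for token, from ★ p858731's one-lattice tokens (level: `|z − 1| ≤ |ϖ|^a`; square level: `|z − 1| ≤ |ϖ|^b`, `(T − 1)·M ⊆ M` from
`T·M = M`) and ★ `mapGL_eq_of_coe_eq_smul` (the fixed vertices agree).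

WHAT IS PROVED.
* `ncard_levels_eq_of_coe_eq_smul` — the `(a, b)`-level count at `z·T` equals that at `T` (`|z| = 1`, `|z − 1| ≤ |ϖ|^a`, `|z − 1| ≤ |ϖ|^b`).
* `ncard_sqLevel_eq_of_coe_eq_smul` — the square-level-`b` count at `z·T` equals that at `T` (`|z| = 1`, `|z − 1| ≤ |ϖ|^b`).
HONEST LABEL.  Count-neutral (`--supports`): lattice bookkeeping; pays no registered stub, touches no `Lines/` module, states no census law; tier-0 rows T₊∕T₋∕reg stay OPEN;
`HC_CM` is proved only modulo the 7 printed citations (2 remaining named inputs: hLiu418 = `stmt-HodgeConjecture-24832`, h413 = `stmt-HodgeConjecture-24833`) until rung 0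
closes.

## References
* [Kottwitz1986BaseChangeUnits] R. E. Kottwitz, *Base change for unit elements of Hecke algebras*, Compositio Math. 60 (1986), §1 pp. 240–241.
* [Rogawski1990] J. D. Rogawski, *Automorphic Representations of Unitary Groups in Three Variables*, Ann. of Math. Stud. 123 (1990), §4.9 Prop. 4.9.1 (b) p. 55, Lemma 4.9.3 p. 56.
* [Tits1979] J. Tits, *Reductive groups over local fields*, PSPM 33.1 (1979), §3.5 (congruence filtrations).
-/

set_option autoImplicit false

noncomputable section

namespace Summit.HodgeConjecture.HodgeConjecture.Cruxes.H413.F0P3cDyRamLevelCountCentralRescaling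

open Literature.NumberTheory.Automorphic Literature.NumberTheory.Automorphic.UnitaryLatticeTree Literature.NumberTheory.Automorphic.HermitianLattice
open Summit.HodgeConjecture.HodgeConjecture.Cruxes.H413.F0P3cDyRamFourFrameCensusDefs
open Summit.HodgeConjecture.HodgeConjecture.Cruxes.H413.F0P3cDyRamProfileCountCentralRescaling
open scoped Matrix MatrixGroups Valued WithZero

variable {K : Type*} [Field K] [Valued K ℤᵐ⁰]

/-- **THE `(a, b)`-LEVEL COUNT IS BLIND TO `T ↦ z·T`** (`|z| = 1`, `|z − 1| ≤ |ϖ|^a`, `|z − 1| ≤ |ϖ|^b`): the census function of ★ `pieceCountDictionary_levels`, token for token.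
[cite: Kottwitz1986BaseChangeUnits, §1 pp. 240–241] [cite: Rogawski1990, §4.9 Prop. 4.9.1 (b) p. 55] [cite: Tits1979, §3.5] -/
theorem ncard_levels_eq_of_coe_eq_smul (σ : K →+* K) {ϖ : K} (hϖ : ϖ ≠ 0) (hϖ1 : Valued.v ϖ ≤ 1) {z : K} (hz1 : Valued.v z = 1) {a b : ℕ}
    (hza : Valued.v (z - 1) ≤ Valued.v ϖ ^ a) (hzb : Valued.v (z - 1) ≤ Valued.v ϖ ^ b)
    {T T' : GL (Fin 3) K} (hT' : (T' : Matrix (Fin 3) (Fin 3) K) = z • (T : Matrix (Fin 3) (Fin 3) K)) :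
    {M : Submodule (Valued.integer K) (Fin 3 → K) |
        IsVertexLattice σ ϖ ((StdForm.antidiagonal 3).over K) 0 M ∧ mapGL T' M = M ∧
          (LatticeInLevel ϖ a ((T' : Matrix (Fin 3) (Fin 3) K) - 1) M ∧
            LatticeInLevel ϖ b (((T' : Matrix (Fin 3) (Fin 3) K) - 1) * ((T' : Matrix (Fin 3) (Fin 3) K) - 1)) M)}.ncard =
      {M : Submodule (Valued.integer K) (Fin 3 → K) |
        IsVertexLattice σ ϖ ((StdForm.antidiagonal 3).over K) 0 M ∧ mapGL T M = M ∧
          (LatticeInLevel ϖ a ((T : Matrix (Fin 3) (Fin 3) K) - 1) M ∧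
            LatticeInLevel ϖ b (((T : Matrix (Fin 3) (Fin 3) K) - 1) * ((T : Matrix (Fin 3) (Fin 3) K) - 1)) M)}.ncard := by
  congr 1
  ext M
  simp only [Set.mem_setOf_eq]
  refine and_congr_right fun _hM => ?_
  rw [mapGL_eq_of_coe_eq_smul hz1 hT' M]
  refine and_congr_right fun hfix => ?_
  have hAM : ∀ x ∈ M, ((T : Matrix (Fin 3) (Fin 3) K) - 1) *ᵥ x ∈ M := fun x hx => sub_one_mulVec_mem_of_mapGL_eq hfix hx
  rw [latticeInLevel_iff_of_eq_smul hϖ hz1 hza hT' M, latticeInLevel_sq_iff_of_eq_smul hϖ hϖ1 hz1 hzb hT' M hAM]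

/-- **THE SQUARE-LEVEL-`b` COUNT IS BLIND TO `T ↦ z·T`** (`|z| = 1`, `|z − 1| ≤ |ϖ|^b`): the census function of ★ `pieceCountDictionary_sqLevel`, token for token.
[cite: Kottwitz1986BaseChangeUnits, §1 pp. 240–241] [cite: Rogawski1990, §4.9 Prop. 4.9.1 (b) p. 55] [cite: Tits1979, §3.5] -/
theorem ncard_sqLevel_eq_of_coe_eq_smul (σ : K →+* K) {ϖ : K} (hϖ : ϖ ≠ 0) (hϖ1 : Valued.v ϖ ≤ 1) {z : K} (hz1 : Valued.v z = 1) {b : ℕ}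
    (hzb : Valued.v (z - 1) ≤ Valued.v ϖ ^ b)
    {T T' : GL (Fin 3) K} (hT' : (T' : Matrix (Fin 3) (Fin 3) K) = z • (T : Matrix (Fin 3) (Fin 3) K)) :
    {M : Submodule (Valued.integer K) (Fin 3 → K) |
        IsVertexLattice σ ϖ ((StdForm.antidiagonal 3).over K) 0 M ∧ mapGL T' M = M ∧
          LatticeInLevel ϖ b (((T' : Matrix (Fin 3) (Fin 3) K) - 1) * ((T' : Matrix (Fin 3) (Fin 3) K) - 1)) M}.ncard =
      {M : Submodule (Valued.integer K) (Fin 3 → K) |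
        IsVertexLattice σ ϖ ((StdForm.antidiagonal 3).over K) 0 M ∧ mapGL T M = M ∧
          LatticeInLevel ϖ b (((T : Matrix (Fin 3) (Fin 3) K) - 1) * ((T : Matrix (Fin 3) (Fin 3) K) - 1)) M}.ncard := by
  congr 1
  ext M
  simp only [Set.mem_setOf_eq]
  refine and_congr_right fun _hM => ?_
  rw [mapGL_eq_of_coe_eq_smul hz1 hT' M]
  refine and_congr_right fun hfix => ?_
  have hAM : ∀ x ∈ M, ((T : Matrix (Fin 3) (Fin 3) K) - 1) *ᵥ x ∈ M := fun x hx => sub_one_mulVec_mem_of_mapGL_eq hfix hx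
  rw [latticeInLevel_sq_iff_of_eq_smul hϖ hϖ1 hz1 hzb hT' M hAM]

end Summit.HodgeConjecture.HodgeConjecture.Cruxes.H413.F0P3cDyRamLevelCountCentralRescaling

end
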